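import Summits.CriticalPhenomena.PercolationContinuityZ3.Theorems.SahiMasterFamilyPhiOrbit
import Summits.CriticalPhenomena.PercolationContinuityZ3.Theorems.SahiMasterFamilyPointwiseTransfer

/-!
# The zero TRANSFER read off P4's certificate checkers (`verify`, `verifyOrbit`), every order

Unit `prim-master-conj` (crux anchor stmt-CriticalPhenomena-4575, helper work), gen 14; memo
`run/shared/lean/prim/prim-l12/prim-master-conj/POINTWISE.md` §11, §14.

Seat P4's reflective checkers (`…PhiCert`: `phiNonneg_of_verify`; `…PhiOrbit`: `phiNonneg_of_verifyOrbit`, `phiNonneg_of_orbitPieces'`) turn an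
exact product-of-atoms certificate for `F(n)` into the kernel theorem `PhiNonneg n` (Sahi's `C_n` on the principal-cap stratum).  The SAME successful
check also proves the second consumer of such certificates, the zero transfer `PT n` of `…PointwiseTransfer`
(`Φ_n(β) = 0 → Φ_n(β') = 0` whenever the three kinds of atoms transfer from `β` to `β'`), which is what the pointwise master conjecture on the
principal-cap / face-vanishing / shared-face-vanishing classes consumes (`Pointwise.sahiE_ind_eq_zero_iff_of_principalCap_of_phiTransfer`,
`…PointwisePrincipalCapSix`, `…PointwiseSharedFaceVanishingAllOrders`).  Proof: the relation
`Tr(x,y) := 0 ≤ x ∧ 0 ≤ y ∧ (x = 0 → y = 0)` is closed under `+` and `·` (`Pointwise.tr_add/tr_mul`), so it passes from the atoms to every checked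
weighted list of atom products (`termsPoly_transfer`); for the orbit basis the relabelled valuations `actV σ β`, `actV σ β'` again have transferring
atoms (`Finset.map_union`), `(n!·M)·Φ_n(γ) = Σ_σ Q(actV σ γ)` for `γ = β, β'`, and a vanishing sum of non-negative transferring terms transfers.
* `atomVal_transfer`, `prod_atomVal_transfer`, `termsPoly_transfer`;
* **`phiTransfer_of_verify`**, **`phiTransfer_of_verifyOrbit`**, **`phiTransfer_of_orbitPieces'`** (the hypotheses of P4's three reflection theorems,
  verbatim, now conclude `PT`);
* `sahiE_ind_eq_zero_iff_of_principalCap_of_verifyOrbit` / `…_of_orbitPieces'`: pointwise (EQ-(n+1)) on the principal-cap stratum straight from a check.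
So once `…PhiOrbitSeven` (P4: `normR_seven`, `reconD_seven`, `dataD_seven`) is in the tree, `PT 7` is
`phiTransfer_of_orbitPieces' 6 2 _ _ _ _ (by decide) dataD_seven normR_seven reconD_seven` and pointwise (EQ-7) on the whole (shared-)face-vanishing
class follows with no further per-order work (file `…PointwisePrincipalCapSeven`, next).
HONEST FRAMING: infrastructure; nothing is asserted about the existence of certificates.  Axioms standard. [this work]
-/

set_option autoImplicit false

namespace Summit.CriticalPhenomena.PercolationContinuityZ3.Theorems

namespace PhiCert

open Finset Literature.Combinatorics.Sahi2008
open Literature.Probability.Percolation.DecisionTree (ind)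
open Pointwise (tr_add tr_mul tr_const)

/-! ## 1. Atoms, products and checked term lists transfer -/

section Terms

variable {n : ℕ} {β β' : Finset (Fin n) → ℝ}

/-- The atoms `b_S`, `d_S`, `h(S;A,B)` transfer from `val β` to `val β'` when the three kinds of set-function atoms do. [this work] -/
theorem atomVal_transfer
    (hb : ∀ B, 0 ≤ β B ∧ 0 ≤ β' B ∧ (β B = 0 → β' B = 0))
    (hd : ∀ B, 0 ≤ 1 - β B ∧ 0 ≤ 1 - β' B ∧ (1 - β B = 0 → 1 - β' B = 0))
    (hg : ∀ S A B : Finset (Fin n), A ∪ B = S →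
      0 ≤ β S - β A * β B ∧ 0 ≤ β' S - β' A * β' B ∧ (β S - β A * β B = 0 → β' S - β' A * β' B = 0)) :
    ∀ a : Atom, a.wf = true →
      0 ≤ atomVal (val β) a ∧ 0 ≤ atomVal (val β') a ∧ (atomVal (val β) a = 0 → atomVal (val β') a = 0)
  | .b S, _ => hb _
  | .d S, _ => hd _
  | .h S A B, hw => by
    have hS : A ||| B = S := by simpa [Atom.wf] using hw
    show 0 ≤ β (ofMask n S) - β (ofMask n A) * β (ofMask n B) ∧ 0 ≤ β' (ofMask n S) - β' (ofMask n A) * β' (ofMask n B) ∧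
      (β (ofMask n S) - β (ofMask n A) * β (ofMask n B) = 0 → β' (ofMask n S) - β' (ofMask n A) * β' (ofMask n B) = 0)
    rw [← hS, ofMask_or]
    exact hg _ _ _ rfl

/-- Products of well-formed atoms transfer. [this work] -/
theorem prod_atomVal_transfer
    (hb : ∀ B, 0 ≤ β B ∧ 0 ≤ β' B ∧ (β B = 0 → β' B = 0))
    (hd : ∀ B, 0 ≤ 1 - β B ∧ 0 ≤ 1 - β' B ∧ (1 - β B = 0 → 1 - β' B = 0))
    (hg : ∀ S A B : Finset (Fin n), A ∪ B = S →
      0 ≤ β S - β A * β B ∧ 0 ≤ β' S - β' A * β' B ∧ (β S - β A * β B = 0 → β' S - β' A * β' B = 0)) :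
    ∀ as : List Atom, (∀ a ∈ as, a.wf = true) →
      0 ≤ (as.map (atomVal (val β))).prod ∧ 0 ≤ (as.map (atomVal (val β'))).prod ∧
        ((as.map (atomVal (val β))).prod = 0 → (as.map (atomVal (val β'))).prod = 0)
  | [], _ => by
    rw [List.map_nil, List.map_nil, List.prod_nil]
    exact tr_const zero_le_one
  | a :: as, hw => by
    rw [List.map_cons, List.map_cons, List.prod_cons, List.prod_cons]
    exact tr_mul (atomVal_transfer hb hd hg a (hw a (by simp)))
      (prod_atomVal_transfer hb hd hg as fun b hb' => hw b (by simp [hb']))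

/-- **A checked weighted list of atom products transfers** (both values `≥ 0`, and zero at `β` forces zero at `β'`). [this work] -/
theorem termsPoly_transfer (huniv : β univ = 1) (huniv' : β' univ = 1)
    (hb : ∀ B, 0 ≤ β B ∧ 0 ≤ β' B ∧ (β B = 0 → β' B = 0))
    (hd : ∀ B, 0 ≤ 1 - β B ∧ 0 ≤ 1 - β' B ∧ (1 - β B = 0 → 1 - β' B = 0))
    (hg : ∀ S A B : Finset (Fin n), A ∪ B = S →
      0 ≤ β S - β A * β B ∧ 0 ≤ β' S - β' A * β' B ∧ (β S - β A * β B = 0 → β' S - β' A * β' B = 0)) :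
    ∀ T : List (ℤ × List Atom), checkT T = true →
      0 ≤ evalP (val β) (termsPoly n T) ∧ 0 ≤ evalP (val β') (termsPoly n T) ∧
        (evalP (val β) (termsPoly n T) = 0 → evalP (val β') (termsPoly n T) = 0)
  | [], _ => by
    rw [termsPoly, evalP, evalP]
    exact tr_const le_rfl
  | t :: T, hT => by
    rw [checkT, Bool.and_eq_true, Bool.and_eq_true] at hT
    obtain ⟨⟨hw, hwf⟩, hT'⟩ := hT
    rw [termsPoly, evalP_append, evalP_append, evalP_scaleP, evalP_scaleP, evalP_prodP β huniv, evalP_prodP β' huniv']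
    exact tr_add
      (tr_mul (tr_const (by exact_mod_cast of_decide_eq_true hw))
        (prod_atomVal_transfer hb hd hg t.2 fun a ha => List.all_eq_true.1 hwf a ha))
      (termsPoly_transfer huniv huniv' hb hd hg T hT')

end Terms

/-! ## 2. The transfer from `verify` (compiled-evaluation checker) -/

/-- **Reflection, transfer form**: a successful `verify` check proves the zero transfer `PT (n+1)` of `…PointwiseTransfer`. [this work] -/
theorem phiTransfer_of_verify (n M : ℕ) (hM : 0 < M) (C : List (ℤ × List Atom)) (h : verify (n + 1) M C = true) :
    ∀ β β' : Finset (Fin (n + 1)) → ℝ, β univ = 1 → β' univ = 1 →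
      (∀ B, 0 ≤ β B ∧ 0 ≤ β' B ∧ (β B = 0 → β' B = 0)) →
      (∀ B, 0 ≤ 1 - β B ∧ 0 ≤ 1 - β' B ∧ (1 - β B = 0 → 1 - β' B = 0)) →
      (∀ S A B : Finset (Fin (n + 1)), A ∪ B = S →
        0 ≤ β S - β A * β B ∧ 0 ≤ β' S - β' A * β' B ∧ (β S - β A * β B = 0 → β' S - β' A * β' B = 0)) →
      PrincipalCapBeta.phiSet (n + 1) β = 0 → PrincipalCapBeta.phiSet (n + 1) β' = 0 := by
  intro β β' hu hu' hb hd hg hz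
  rw [verify, Bool.and_eq_true, decide_eq_true_eq] at h
  obtain ⟨hT, hid⟩ := h
  have key : ∀ γ : Finset (Fin (n + 1)) → ℝ, γ univ = 1 →
      (M : ℝ) * PrincipalCapBeta.phiSet (n + 1) γ = evalP (val γ) (termsPoly (n + 1) (certTerms (n + 1) C)) := by
    intro γ hγ
    rw [← evalP_symE_singletons γ hγ, ← evalP_normP (val γ) (termsPoly _ _), ← hid, evalP_normP, evalP_scaleP]
    push_cast; ring
  have T := termsPoly_transfer hu hu' hb hd hg _ hT
  have e1 : evalP (val β) (termsPoly (n + 1) (certTerms (n + 1) C)) = 0 := by rw [← key β hu, hz, mul_zero]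
  have e2 := T.2.2 e1
  rw [← key β' hu'] at e2
  have hM' : (M : ℝ) ≠ 0 := by exact_mod_cast hM.ne'
  exact (mul_eq_zero.1 e2).resolve_left hM'

/-! ## 3. The transfer from `verifyOrbit` (kernel checker, orbit basis) -/

section Orbit

variable {n : ℕ}

/-- Base atoms of a relabelled valuation transfer. [this work] -/
theorem actV_transfer_base (σ : Equiv.Perm (Fin n)) {β β' : Finset (Fin n) → ℝ}
    (hb : ∀ B, 0 ≤ β B ∧ 0 ≤ β' B ∧ (β B = 0 → β' B = 0)) (B : Finset (Fin n)) :
    0 ≤ actV σ β B ∧ 0 ≤ actV σ β' B ∧ (actV σ β B = 0 → actV σ β' B = 0) :=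
  hb _

/-- Defect atoms of a relabelled valuation transfer. [this work] -/
theorem actV_transfer_defect (σ : Equiv.Perm (Fin n)) {β β' : Finset (Fin n) → ℝ}
    (hd : ∀ B, 0 ≤ 1 - β B ∧ 0 ≤ 1 - β' B ∧ (1 - β B = 0 → 1 - β' B = 0)) (B : Finset (Fin n)) :
    0 ≤ 1 - actV σ β B ∧ 0 ≤ 1 - actV σ β' B ∧ (1 - actV σ β B = 0 → 1 - actV σ β' B = 0) :=
  hd _

/-- Gap atoms of a relabelled valuation transfer (relabelling preserves covers). [this work] -/
theorem actV_transfer_gap (σ : Equiv.Perm (Fin n)) {β β' : Finset (Fin n) → ℝ}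
    (hg : ∀ S A B : Finset (Fin n), A ∪ B = S →
      0 ≤ β S - β A * β B ∧ 0 ≤ β' S - β' A * β' B ∧ (β S - β A * β B = 0 → β' S - β' A * β' B = 0))
    (S A B : Finset (Fin n)) (hS : A ∪ B = S) :
    0 ≤ actV σ β S - actV σ β A * actV σ β B ∧ 0 ≤ actV σ β' S - actV σ β' A * actV σ β' B ∧
      (actV σ β S - actV σ β A * actV σ β B = 0 → actV σ β' S - actV σ β' A * actV σ β' B = 0) := by
  subst hS
  unfold actV
  rw [Finset.map_union]
  exact hg _ _ _ rfl

/-- **Reflection, orbit basis, transfer form**: a successful `verifyOrbit` check proves the zero transfer `PT (n+1)`. [this work] -/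
theorem phiTransfer_of_verifyOrbit (n M : ℕ) (hM : 0 < M) (C : List (ℤ × List Atom)) (D : List (ℤ × List ℕ × Mono))
    (h : verifyOrbit (n + 1) M C D = true) :
    ∀ β β' : Finset (Fin (n + 1)) → ℝ, β univ = 1 → β' univ = 1 →
      (∀ B, 0 ≤ β B ∧ 0 ≤ β' B ∧ (β B = 0 → β' B = 0)) →
      (∀ B, 0 ≤ 1 - β B ∧ 0 ≤ 1 - β' B ∧ (1 - β B = 0 → 1 - β' B = 0)) →
      (∀ S A B : Finset (Fin (n + 1)), A ∪ B = S →
        0 ≤ β S - β A * β B ∧ 0 ≤ β' S - β' A * β' B ∧ (β S - β A * β B = 0 → β' S - β' A * β' B = 0)) →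
      PrincipalCapBeta.phiSet (n + 1) β = 0 → PrincipalCapBeta.phiSet (n + 1) β' = 0 := by
  intro β β' hu hu' hb hd hg hz
  rw [verifyOrbit, Bool.and_eq_true, Bool.and_eq_true, Bool.and_eq_true, decide_eq_true_eq, decide_eq_true_eq] at h
  obtain ⟨⟨⟨hT, hD⟩, hRD⟩, hzero⟩ := h
  set R : Poly := termsPolyN (n + 1) C ++ scaleP (-(M : ℤ)) (symEN (n + 1) (n + 1) fun i => 2 ^ (i : ℕ)) with hR
  -- the identity `(n+1)!·M·Φ(γ) = Σ_σ Q(actV σ γ)` for every feasible `γ`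
  have key : ∀ γ : Finset (Fin (n + 1)) → ℝ, γ univ = 1 →
      ((Nat.factorial (n + 1) : ℕ) : ℝ) * ((M : ℝ) * PrincipalCapBeta.phiSet (n + 1) γ) =
        ∑ σ : Equiv.Perm (Fin (n + 1)), evalP (val (actV σ γ)) (termsPoly (n + 1) C) := by
    intro γ hγ
    have hR0 : evalSym γ R = 0 := by
      rw [← evalSym_normP, ← hRD, evalSym_recon γ D hD, ← evalSym_normP, hzero]
      simp [evalSym, evalP]
    have huσ : ∀ σ : Equiv.Perm (Fin (n + 1)), actV σ γ univ = 1 := fun σ => by rw [actV_univ, hγ]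
    have hRσ : ∀ σ : Equiv.Perm (Fin (n + 1)), evalP (val (actV σ γ)) R =
        evalP (val (actV σ γ)) (termsPoly (n + 1) C) - (M : ℝ) * PrincipalCapBeta.phiSet (n + 1) γ := by
      intro σ
      rw [hR, evalP_append, evalP_scaleP, evalP_termsPolyN, evalP_symEN_singletons _ (huσ σ), phiSet_actV]
      push_cast
      ring
    have hsum : evalSym γ R = (∑ σ : Equiv.Perm (Fin (n + 1)), evalP (val (actV σ γ)) (termsPoly (n + 1) C)) -
        ((Nat.factorial (n + 1) : ℕ) : ℝ) * ((M : ℝ) * PrincipalCapBeta.phiSet (n + 1) γ) := by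
      unfold evalSym
      rw [Finset.sum_congr rfl fun σ _ => hRσ σ, Finset.sum_sub_distrib, Finset.sum_const, Finset.card_univ,
        Fintype.card_perm, Fintype.card_fin, nsmul_eq_mul]
    linarith [hsum, hR0]
  -- every summand transfers from `β` to `β'`
  have hTr : ∀ σ : Equiv.Perm (Fin (n + 1)),
      0 ≤ evalP (val (actV σ β)) (termsPoly (n + 1) C) ∧ 0 ≤ evalP (val (actV σ β')) (termsPoly (n + 1) C) ∧
        (evalP (val (actV σ β)) (termsPoly (n + 1) C) = 0 → evalP (val (actV σ β')) (termsPoly (n + 1) C) = 0) :=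
    fun σ => termsPoly_transfer (by rw [actV_univ, hu]) (by rw [actV_univ, hu'])
      (actV_transfer_base σ hb) (actV_transfer_defect σ hd) (actV_transfer_gap σ hg) C hT
  -- the sum vanishes at `β`, hence termwise, hence termwise at `β'`, hence the sum at `β'`
  have hsum0 : ∑ σ : Equiv.Perm (Fin (n + 1)), evalP (val (actV σ β)) (termsPoly (n + 1) C) = 0 := by
    rw [← key β hu, hz, mul_zero, mul_zero]
  have hterm : ∀ σ ∈ (univ : Finset (Equiv.Perm (Fin (n + 1)))), evalP (val (actV σ β)) (termsPoly (n + 1) C) = 0 :=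
    (Finset.sum_eq_zero_iff_of_nonneg fun σ _ => (hTr σ).1).1 hsum0
  have hsum0' : ∑ σ : Equiv.Perm (Fin (n + 1)), evalP (val (actV σ β')) (termsPoly (n + 1) C) = 0 :=
    Finset.sum_eq_zero fun σ hσ => (hTr σ).2.2 (hterm σ hσ)
  have e := key β' hu'
  rw [hsum0'] at e
  have hfac : ((Nat.factorial (n + 1) : ℕ) : ℝ) ≠ 0 := by exact_mod_cast (Nat.factorial_pos (n + 1)).ne'
  have hM' : (M : ℝ) ≠ 0 := by exact_mod_cast hM.ne'
  rcases mul_eq_zero.1 e with h1 | h2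
  · exact absurd h1 hfac
  · exact (mul_eq_zero.1 h2).resolve_left hM'

/-- **Reflection, orbit basis, in pieces, transfer form** — the hypotheses of P4's `phiNonneg_of_orbitPieces'` VERBATIM (so the data declarations of
`…PhiOrbitSeven` — `dataD_seven`, `normR_seven`, `reconD_seven` — can be reused as they stand) conclude the zero transfer `PT (n+1)`. [this work] -/
theorem phiTransfer_of_orbitPieces' (n M : ℕ) (hM : 0 < M) (C : List (ℤ × List Atom)) (D : List (ℤ × List ℕ × Mono)) (RD : Poly)
    (hT : checkT C = true)
    (hDZ : checkDZ (n + 1) D = true)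
    (hR : normP (termsPolyN (n + 1) C ++ scaleP (-(M : ℤ)) (symEN (n + 1) (n + 1) fun i => 2 ^ (i : ℕ))) = RD)
    (hrec : D.map (recon (n + 1)) = RD) :
    ∀ β β' : Finset (Fin (n + 1)) → ℝ, β univ = 1 → β' univ = 1 →
      (∀ B, 0 ≤ β B ∧ 0 ≤ β' B ∧ (β B = 0 → β' B = 0)) →
      (∀ B, 0 ≤ 1 - β B ∧ 0 ≤ 1 - β' B ∧ (1 - β B = 0 → 1 - β' B = 0)) →
      (∀ S A B : Finset (Fin (n + 1)), A ∪ B = S →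
        0 ≤ β S - β A * β B ∧ 0 ≤ β' S - β' A * β' B ∧ (β S - β A * β B = 0 → β' S - β' A * β' B = 0)) →
      PrincipalCapBeta.phiSet (n + 1) β = 0 → PrincipalCapBeta.phiSet (n + 1) β' = 0 := by
  refine phiTransfer_of_verifyOrbit n M hM C D ?_
  rw [checkDZ, Bool.and_eq_true, decide_eq_true_eq] at hDZ
  rw [verifyOrbit, hT, hDZ.1, hR, hrec, hDZ.2]
  simp

end Orbit

/-! ## 4. Pointwise (EQ) on the principal-cap stratum straight from a check, every order -/

/-- **Pointwise (EQ-(n+1)) on the principal-cap stratum from a successful `verifyOrbit` check**: for `p` in the open cube and `n+1` increasing events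
whose common part is a principal up-set, `E_{n+1}(μ_p; 1_U) = 0 ↔ U ∈ Z_{n+1}`. [this work] -/
theorem sahiE_ind_eq_zero_iff_of_principalCap_of_verifyOrbit {ι : Type} [Fintype ι] (n M : ℕ) (hM : 0 < M) (C : List (ℤ × List Atom))
    (D : List (ℤ × List ℕ × Mono)) (h : verifyOrbit (n + 1) M C D = true)
    {p : ι → unitInterval} (hp : ∀ e, (p e : ℝ) ∈ Set.Ioo (0 : ℝ) 1) (U : Fin (n + 1) → Set (Set ι))
    (hU : ∀ j, IsUpperSet (U j)) (c₀ : Finset ι) (hpc : ∀ T : Set ι, (∀ j, T ∈ U j) ↔ (↑c₀ : Set ι) ⊆ T) :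
    sahiE (bernoulliWeight p) (n + 1) (fun j => ind (U j)) = 0 ↔ SuppZeroFlag (n + 1) U :=
  Pointwise.sahiE_ind_eq_zero_iff_of_principalCap_of_phiTransfer (phiTransfer_of_verifyOrbit n M hM C D h) hp U hU c₀ hpc

/-- **Pointwise (EQ-(n+1)) on the principal-cap stratum from the piecewise orbit check.** [this work] -/
theorem sahiE_ind_eq_zero_iff_of_principalCap_of_orbitPieces' {ι : Type} [Fintype ι] (n M : ℕ) (hM : 0 < M) (C : List (ℤ × List Atom))
    (D : List (ℤ × List ℕ × Mono)) (RD : Poly) (hT : checkT C = true) (hDZ : checkDZ (n + 1) D = true)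
    (hR : normP (termsPolyN (n + 1) C ++ scaleP (-(M : ℤ)) (symEN (n + 1) (n + 1) fun i => 2 ^ (i : ℕ))) = RD)
    (hrec : D.map (recon (n + 1)) = RD)
    {p : ι → unitInterval} (hp : ∀ e, (p e : ℝ) ∈ Set.Ioo (0 : ℝ) 1) (U : Fin (n + 1) → Set (Set ι))
    (hU : ∀ j, IsUpperSet (U j)) (c₀ : Finset ι) (hpc : ∀ T : Set ι, (∀ j, T ∈ U j) ↔ (↑c₀ : Set ι) ⊆ T) :
    sahiE (bernoulliWeight p) (n + 1) (fun j => ind (U j)) = 0 ↔ SuppZeroFlag (n + 1) U :=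
  Pointwise.sahiE_ind_eq_zero_iff_of_principalCap_of_phiTransfer (phiTransfer_of_orbitPieces' n M hM C D RD hT hDZ hR hrec) hp U hU c₀ hpc

/-- **Strict form**: off `Z_{n+1}`, a principal-cap family has `E_{n+1}(μ_p; 1_U) > 0` at every interior `p`, from one successful `verifyOrbit` check
(which gives both `F(n+1)` and the transfer). [this work] -/
theorem sahiE_ind_pos_of_principalCap_of_verifyOrbit {ι : Type} [Fintype ι] (n M : ℕ) (hM : 0 < M) (C : List (ℤ × List Atom))
    (D : List (ℤ × List ℕ × Mono)) (h : verifyOrbit (n + 1) M C D = true)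
    {p : ι → unitInterval} (hp : ∀ e, (p e : ℝ) ∈ Set.Ioo (0 : ℝ) 1) (U : Fin (n + 1) → Set (Set ι))
    (hU : ∀ j, IsUpperSet (U j)) (c₀ : Finset ι) (hpc : ∀ T : Set ι, (∀ j, T ∈ U j) ↔ (↑c₀ : Set ι) ⊆ T)
    (hZ : ¬ SuppZeroFlag (n + 1) U) :
    0 < sahiE (bernoulliWeight p) (n + 1) (fun j => ind (U j)) :=
  lt_of_le_of_ne (PrincipalCapBeta.sahiE_ind_nonneg_of_phiNonneg (phiNonneg_of_verifyOrbit n M hM C D h) p U hU c₀ hpc)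
    (fun h0 => hZ ((sahiE_ind_eq_zero_iff_of_principalCap_of_verifyOrbit n M hM C D h hp U hU c₀ hpc).1 h0.symm))

end PhiCert

end Summit.CriticalPhenomena.PercolationContinuityZ3.Theorems
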